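import Literature.IUT.HodgeTheaters.Ex54ivInfKappaArithRatGalois
import Literature.IUT.HodgeTheaters.KappaCoricRatGaloisLocalKit
import Literature.IUT.HodgeTheaters.KappaCoricRatGaloisRestrictionConstants
import Literature.IUT.HodgeTheaters.KappaCoricRatGaloisCritLocusGeom
import Literature.IUT.HodgeTheaters.InitialThetaDataCurveModelLaws
import HarnessLib

/-!
# [IUTchI] Example 5.1 (i) / Example 5.4 (iv): the RECONSTRUCTION-PRESENTED rational objects of an initial
# Θ-datum from the [AbsTopIII] Thm 1.9 instance binder `(h₁₉ : Thm_1_9 D.nfCurveModel)`, and their identification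
# with the arithmetic function-field model `Λ_F ⊇ F(t)`, `G_F^{rat}` (GAP B = G-L5t9g8-1, item GB-09 = memo row D9,
# objects half: `InitialThetaData.reconRatObjects`, `InitialThetaData.reconIdentification`)

S. Mochizuki, *Inter-universal Teichmüller theory I*, kurims manuscript (May 2020), Example 5.1 (i) pp. 123–124
(«by applying [AbsTopIII] Theorem 1.9, via the Θ-approach, we may construct group-theoretically from `π₁(†𝒟^⊛)`
isomorphs `π₁^{rat}(†𝒟^⊛) ↠ π₁(†𝒟^⊛)` of the absolute Galois group of the function field of `C_{F_mod}` … natural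
isomorphs `𝕄^⊛_∞κ(†𝒟^⊚)` … equipped with natural `π₁^{rat}(†𝒟^⊛)`-actions»), Example 5.4 (iv) p. 149 (the
`∞κ`-compatibility clause, typed ★ p510882/★ p513361 as `BaseThetaDatum.S5Local.InfKappaLink` / `Ex54ivInfKappaCompat`);
S. Mochizuki, *Topics in Absolute Anabelian Geometry III*, Thm 1.9 p. 37 (tree: `AbsTopIII.Thm_1_9 (M : CurveModel)`,
`Reconstruction.lean` :164, an instance form «consumable only AT A NAMED MODEL»). ([IUTchI] Ex 5.1 (i) p.124)
[claim: Mochizuki2012, status: disputed] (D-0012 claim key — the content of THIS file is elementary field theory: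
choice from an `∃`, extension of a field isomorphism to algebraic closures, conjugation of Galois groups; nothing
disputed is used and no side is taken on [IUTchIII] Cor. 3.12).

## What this file builds (cell abc-iut; `GAP-SIZING-B.md` 2de24246389ab103 §2 row D9 first half; `plan/GAP-ITEMS.tsv`
row GB-09; RULINGS #315 (2) / #316 (ii) «the PROVENANCE layer C2 − C1: the named `CurveModel` interface at
`InitialThetaData.nfCurveModel` + the [AbsTopIII] Thm 1.9 INSTANCE binder BY NAME + the transport of (i) along them»;
RULINGS #340 (A) «design (B): Λ_F = GB-01's `RatAlgClosure F` … GB-09's identification target ON THE NOSE;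
`NFFunctionField CF = RatFunc Fbar` sits inside as the image of GB-02's `geomEmb F`»)

Given a genuine initial Θ-datum `D` (GB-07's named model `D.nfCurveModel` ★ p668585, whose curve `C_F` has
`ext = D.geom.extF` = the interface `Π_{C_F} ↠ G_F` and `NFFunctionField = RatFunc Fbar = F̄(t)`, both `rfl`) and the
binder `(h₁₉ : AbsTopIII.Thm_1_9 D.nfCurveModel)` BY NAME:
* `D.reconRatObjects h₁₉ : D.ReconRatObjects` — the functorial group-theoretic algorithm `A : NFPortionAlgorithm` CHOSEN
  (`Classical.choice`) from `h₁₉ : ∃ A, …`, together with its comparison clauses at the four curves of the model;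
  for `R : D.ReconRatObjects`: `R.nfPortion = A(Π_{C_F})` (the Thm-1.9 OUTPUT at the real `†𝒟^⊛ = Π_{C_F}`),
  `R.funField = K_A :=` its reconstructed NF-function field «`K_{Z_NF}^× ∪ {0}`», `R.funFieldEquiv : K_A ≃+* F̄(t)` CHOSEN
  from the comparison clause `Nonempty (… ≃+* NFFunctionField C_F)` (one representative), `R.ratClosure = Λ_A :=
  AlgebraicClosure K_A` (the reconstruction-presented `L̄_C`), `R.funFieldAlgebra` = the ARITHMETIC structure
  `F(t) → F̄(t) ≅ K_A` (a `def`, not an instance), `R.ratGal = G_A^{rat} := Gal(Λ_A / F(t))` (the reconstruction-presented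
  `π₁^{rat}(†𝒟^⊛)` of design (B)), Galois, compact Hausdorff totally disconnected;
* the MODEL-side geometric embedding `D.nfRatEmb : F̄(t) ↪ Λ_F := RatAlgClosure F` over `F(t)` (GB-02's `geomEmb F`
  after `D.geomConstantsEquiv : Fbar ≃ₐ[F] geomConstants F`), `nfRatEmb_comp_ratFuncMapCoeffs` (it IS over `F(t)`),
  `isAlgClosure_nfRat` (`Λ_F` is an algebraic closure of `F̄(t)` too);
* **`D.reconIdentification R : Λ_A ≃+* Λ_F`** — `IsAlgClosure.equivOfEquiv` EXTENDING `nfRatEmb ∘ R.funFieldEquiv`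
  (`reconIdentification_algebraMap`), `F(t)`-LINEAR (`reconIdentification_algebraMap_base`; bundled
  `reconIdentificationAlg : Λ_A ≃ₐ[F(t)] Λ_F`), and the induced **`D.reconRatGalEquiv R : G_A^{rat} ≃ₜ* RatGal F`**
  (conjugation; an isomorphism of TOPOLOGICAL groups for the two Krull topologies — GB-07's `autCongrContinuous`) with
  the equivariance `reconIdentification_smul : e (σ • x) = ρ(σ) • e x` («Galois-compatible, topology transported»).
The `∞κ`-coric structure `G_A^{rat} ↷ 𝕄_∞κ(Λ_A)` at GB-04's locus and its identification with GB-01/GB-02's pair is the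
companion file `FrobenioidBridgeEx54ivInfKappaArithTransportCoric.lean` (same item); the producer `P`
(`InfKappaLink` + `Ex54ivInfKappaCompat` by transport) is item GB-14, not here.

HONEST LABELS.  (1) PROVENANCE: `K_A`, `Λ_A` are the OUTPUT TYPES of the algorithm the binder `h₁₉` asserts to exist
— a reconstruction PRESENTATION in the sense of RULINGS #316 (ii); `h₁₉` is a hypothesis BY NAME at a named model, never
the refuted `∀ M`-form (`not_forall_thm_1_9_b`), and nothing here proves it.  (2) WHAT IS TRANSPORTED, NOT
RECONSTRUCTED: the comparison clause of `Thm_1_9` supplies a bare ring isomorphism `K_A ≃+* F̄(t)` (no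
`Π_{C_F}`-equivariance is typed), so the ARITHMETIC descent datum `F(t) ⊂ F̄(t)` — hence `G_A^{rat}` as a group OVER
`F(t)` — is the MODEL's, carried into `K_A ⊂ Λ_A` along the chosen isomorphism (design (B), RULINGS #340 (A): print's
`π₁^{rat}(†𝒟^⊛)` is the arithmetic absolute Galois group; `C_{F_mod}` is absent from `ThetaGeometry`, `[F : F_mod] < ∞`,
memo R5); every identification is ONE representative (`Classical.choice`, `IsAlgClosure.equiv(OfEquiv)`), any two
differing by an element of `G_F^{rat}` (print's rider «up to inner automorphisms of `π₁^{rat}(†𝒟^⊛)`», Ex 5.4 (iv)).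
(3) Definitions + elementary theorems only: no `instance` (algebra structures are `def`s bound with `letI`), no
notation, no axiom, no `sorry`; count-neutral (the token moves only on GB-14/GB-15 by a chair RULINGS line); typed ≠
inhabited ≠ proved-in-print; nothing here asserts that abc is proved or refuted.
-/

noncomputable section

namespace Literature.IUT.HodgeTheaters

open Polynomial
open scoped Pointwise
open Literature.AnabelianGeometry.AbsoluteAnabelian
open Literature.AnabelianGeometry.AbsoluteAnabelian.AbsTopIII
open Literature.FieldTheory.FunctionField

universe u

namespace InitialThetaData

variable {F K Fbar : Type u} [Field F] [NumberField F] [Field K] [NumberField K] [Algebra F K]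
  [Field Fbar] [Algebra F Fbar] [Algebra K Fbar] {E : WeierstrassCurve F} [E.IsElliptic] {l : ℕ}
  {Pb : BadPlacePredicates K} (D : InitialThetaData F K Fbar E l Pb)

/-! ### 1. The reconstruction data chosen from `h₁₉` -/

/-- **The [AbsTopIII] Thm-1.9 reconstruction data at the named model `D.nfCurveModel`**: a functorial
group-theoretic algorithm `A : NFPortionAlgorithm` (outputs on EVERY abstract extension, transport `map` along
isomorphisms, `comap`/`comapBase` along open injections / base changes) together with the COMPARISON clauses of
`Thm_1_9 D.nfCurveModel` for `A` at the four global curves `C_F, X_F, C_K, X_K`: (a) NF-point decomposition groups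
(empty at this model), (d)(e) `constField ≃+* k̄_NF`, `functionField ≃+* K_{Z_NF}` (`= F̄(t)` at `C_F`).  A term of this
type is literally a witness of `Thm_1_9 D.nfCurveModel` (`ReconRatObjects.thm_1_9`); `D.reconRatObjects h₁₉` CHOOSES
one from the binder.  PROVENANCE label (1) of the module docstring. ([IUTchI] Ex 5.1 (i) p.124)
[claim: Mochizuki2012, status: disputed] -/
structure ReconRatObjects : Type (u + 2) where
  /-- the functorial group-theoretic algorithm of [AbsTopIII] Thm 1.9 («group-theoretic software») -/
  alg : NFPortionAlgorithm.{u}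
  /-- its comparison clauses at the model `D.nfCurveModel` (the body of `Thm_1_9 D.nfCurveModel`) -/
  spec : ∀ X : D.nfCurveModel.Curve, D.nfCurveModel.IsThm19Input X →
    (alg.obj (D.nfCurveModel.ext X)).nfPointDecomp =
        {H | ∃ (x : D.nfCurveModel.Point X) (g : (D.nfCurveModel.ext X).arith),
          D.nfCurveModel.IsNFPoint X x ∧ H = MulAut.conj g • D.nfCurveModel.decomp X x}
      ∧ Nonempty ((alg.obj (D.nfCurveModel.ext X)).constField ≃+* D.nfCurveModel.kbarNF X)
      ∧ Nonempty ((alg.obj (D.nfCurveModel.ext X)).functionField ≃+* D.nfCurveModel.NFFunctionField X)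

/-- **`InitialThetaData.reconRatObjects` (GB-09, ruled name)** — the reconstruction data CHOSEN from the instance
binder `(h₁₉ : AbsTopIII.Thm_1_9 D.nfCurveModel)` BY NAME (`Classical.choice` on `∃ A : NFPortionAlgorithm, …`,
`Reconstruction.lean` :164).  All objects below (`funField`, `ratClosure`, `ratGal`, `reconIdentification`,
`reconRatGalEquiv`) are functions of this term. ([IUTchI] Ex 5.1 (i) p.124) [claim: Mochizuki2012, status: disputed] -/
def reconRatObjects (h₁₉ : Thm_1_9 D.nfCurveModel) : D.ReconRatObjects :=
  ⟨h₁₉.choose, h₁₉.choose_spec⟩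

namespace ReconRatObjects

variable {D} (R : D.ReconRatObjects)

/-- A term of `ReconRatObjects` IS a witness of the binder `Thm_1_9 D.nfCurveModel` (nothing is added to it).
([IUTchI] Ex 5.1 (i) p.124) [claim: Mochizuki2012, status: disputed] -/
theorem thm_1_9 (R : D.ReconRatObjects) : Thm_1_9 D.nfCurveModel := ⟨R.alg, R.spec⟩

/-- **The Thm-1.9 OUTPUT at the real `†𝒟^⊛`**: `A(Π_{C_F} ↠ G_F)`, the NF-portion record the algorithm assigns to the
interface extension `D.geom.extF` of the curve `C_F` of the model (`D.nfCurveModel.ext (D.nfCurve .CF) = D.geom.extF`,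
`rfl`).  Print: «†𝕄^⊛ … by [AbsTopIII] Thm 1.9» (Ex 5.1 (i)). ([IUTchI] Ex 5.1 (i) p.124) [claim: Mochizuki2012, status: disputed] -/
abbrev nfPortion : NFPortion D.geom.extF := R.alg.obj D.geom.extF

/-- **`K_A`** — the RECONSTRUCTED NF-function field of `C_F` («`K_{Z_NF}^× ∪ {0}` with its additive structure»,
[AbsTopIII] Thm 1.9 (e)), a field (instance inherited from `NFPortion`). ([IUTchI] Ex 5.1 (i) p.124)
[claim: Mochizuki2012, status: disputed] -/
abbrev funField : Type u := R.nfPortion.functionField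

/-- The comparison clause of the binder at `C_F`: `K_A` is ring-isomorphic to the model's NF-function field
`F̄(t) = RatFunc Fbar` of `C_F` (`C_F` is a Thm-1.9 input: GB-07's `isThm19Input_nfCurveModel`).
([IUTchI] Ex 5.1 (i) p.124) [claim: Mochizuki2012, status: disputed] -/
theorem nonempty_funFieldEquiv : Nonempty (R.funField ≃+* RatFunc Fbar) :=
  (R.spec (D.nfCurve .CF) (D.isThm19Input_nfCurveModel _)).2.2

/-- **`φ_A : K_A ≃+* F̄(t)`** — ONE CHOSEN comparison isomorphism of the reconstructed NF-function field of `C_F` with the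
model's `RatFunc Fbar` (`Classical.choice`; label (2): any two choices differ by a ring automorphism of `F̄(t)`).
([IUTchI] Ex 5.1 (i) p.124) [claim: Mochizuki2012, status: disputed] -/
def funFieldEquiv : R.funField ≃+* RatFunc Fbar := Classical.choice R.nonempty_funFieldEquiv

/-- The comparison clause of the binder at `C_F` for the constants: `A`'s `constField` («`k̄_NF^× ∪ {0}`») is
ring-isomorphic to the model's `k̄_NF` (`= ⊤`, all of `F^{alg}`, GB-07's `kbarNF_nfCurveModel_eq_top`).
([IUTchI] Ex 5.1 (i) p.124) [claim: Mochizuki2012, status: disputed] -/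
theorem nonempty_constFieldEquiv :
    Nonempty (R.nfPortion.constField ≃+* D.nfCurveModel.kbarNF (D.nfCurve .CF)) :=
  (R.spec (D.nfCurve .CF) (D.isThm19Input_nfCurveModel _)).2.1

/-- Clause (a) of the binder at `C_F`: the algorithm's NF-point decomposition data at `Π_{C_F}` is EMPTY (the model
`nfCurveModel` records no closed points — GB-07's honest label; a points-enriched binder implies this one,
`thm_1_9_nfCurveModel_of_points`). ([IUTchI] Ex 5.1 (i) p.124) [claim: Mochizuki2012, status: disputed] -/
theorem nfPointDecomp_eq_empty : R.nfPortion.nfPointDecomp = ∅ := by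
  change (R.alg.obj (D.nfCurveModel.ext (D.nfCurve .CF))).nfPointDecomp = ∅
  rw [(R.spec (D.nfCurve .CF) (D.isThm19Input_nfCurveModel _)).1]
  exact Set.eq_empty_of_forall_notMem fun H ⟨x, _⟩ => (D.isEmpty_point _).elim x

/-- **`Λ_A`** — an algebraic closure of the reconstructed function field `K_A` (the reconstruction-presented `L̄_C` of
Rmk 3.1.7 (ii), on which `π₁^{rat}(†𝒟^⊛)` acts and in which `†𝕄^⊛_∞κ` lives): Mathlib's `AlgebraicClosure K_A`.
([IUTchI] Ex 5.1 (i) p.124) [claim: Mochizuki2012, status: disputed] -/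
abbrev ratClosure : Type u := AlgebraicClosure R.funField

end ReconRatObjects

/-! ### 2. Model side: `F̄(t) ↪ Λ_F` over `F(t)` (design (B) target, RULINGS #340 (A)) -/

/-- The datum's `F̄ = Fbar` (Def 3.1 (a)) identified with the GEOMETRIC CONSTANTS `F̄ ⊂ Λ_F` of GB-02 (`geomConstants F`,
the algebraic closure of `F` inside `Λ_F = AlgebraicClosure (F(t))`): `IsAlgClosure.equiv` (a choice).
([IUTchI] Ex 5.1 (i) p.124) [claim: Mochizuki2012, status: disputed] -/
def geomConstantsEquiv : Fbar ≃ₐ[F] CriticalLocus.geomConstants F :=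
  haveI := D.isAlgClosure
  haveI : Module.IsTorsionFree F Fbar := DivisionSemiring.to_moduleIsTorsionFree
  haveI : Module.IsTorsionFree F (CriticalLocus.geomConstants F) := DivisionSemiring.to_moduleIsTorsionFree
  IsAlgClosure.equiv F Fbar (CriticalLocus.geomConstants F)

/-- **`θ : F̄(t) ↪ Λ_F`** — the model's NF-function field `NFFunctionField C_F = RatFunc Fbar` of `C_F` INSIDE
`Λ_F = RatAlgClosure F`: constant-field transport along `geomConstantsEquiv` followed by GB-02's `geomEmb F`
(`t ↦ t`; «`NFFunctionField CF` sits inside as the image of `geomEmb F`», RULINGS #340 (A)).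
([IUTchI] Ex 5.1 (i) p.124) [claim: Mochizuki2012, status: disputed] -/
def nfRatEmb : RatFunc Fbar →+* RatAlgClosure F :=
  (CriticalLocus.geomEmb F).toRingHom.comp
    (ratFuncMapCoeffs (D.geomConstantsEquiv : Fbar →+* CriticalLocus.geomConstants F))

/-- `θ (t) = t`. ([IUTchI] Ex 5.1 (i) p.124) [claim: Mochizuki2012, status: disputed] -/
theorem nfRatEmb_X : D.nfRatEmb RatFunc.X = algebraMap (RatFunc F) (RatAlgClosure F) RatFunc.X := by
  simp [nfRatEmb, ratFuncMapCoeffs_X, CriticalLocus.geomEmb_X, CriticalLocus.ratVar]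

/-- `θ` on a constant `c ∈ F̄` is the geometric constant `geomConstantsEquiv c ∈ Λ_F`.
([IUTchI] Ex 5.1 (i) p.124) [claim: Mochizuki2012, status: disputed] -/
theorem nfRatEmb_C (c : Fbar) :
    D.nfRatEmb (RatFunc.C c) = ((D.geomConstantsEquiv c : CriticalLocus.geomConstants F) : RatAlgClosure F) := by
  simp [nfRatEmb, ratFuncMapCoeffs_C, CriticalLocus.geomEmb_C]

/-- `θ` on a constant of `F`: `θ (C a) = a ∈ Λ_F`. ([IUTchI] Ex 5.1 (i) p.124) [claim: Mochizuki2012, status: disputed] -/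
theorem nfRatEmb_C_algebraMap (a : F) :
    D.nfRatEmb (RatFunc.C (algebraMap F Fbar a)) = algebraMap F (RatAlgClosure F) a := by
  rw [nfRatEmb_C, AlgEquiv.commutes, IntermediateField.coe_algebraMap_apply]

/-- **`θ` is OVER `F(t)`**: restricted along the constant-field extension `F(t) → F̄(t)` it is the structure map
`F(t) → Λ_F` (ring maps out of the fraction field `F(t)` of `F[t]` agreeing on `F` and on `t` agree).
([IUTchI] Ex 5.1 (i) p.124) [claim: Mochizuki2012, status: disputed] -/
theorem nfRatEmb_comp_ratFuncMapCoeffs :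
    D.nfRatEmb.comp (ratFuncMapCoeffs (algebraMap F Fbar)) = algebraMap (RatFunc F) (RatAlgClosure F) := by
  refine IsLocalization.ringHom_ext (nonZeroDivisors F[X]) (Polynomial.ringHom_ext (fun a => ?_) ?_)
  · simp only [RingHom.comp_apply, RatFunc.algebraMap_C, ratFuncMapCoeffs_C, nfRatEmb_C_algebraMap]
    rw [IsScalarTower.algebraMap_apply F (RatFunc F) (RatAlgClosure F), RatFunc.algebraMap_eq_C]
  · simp only [RingHom.comp_apply, RatFunc.algebraMap_X, ratFuncMapCoeffs_X, nfRatEmb_X]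

/-- `θ` over `F(t)`, pointwise. ([IUTchI] Ex 5.1 (i) p.124) [claim: Mochizuki2012, status: disputed] -/
theorem nfRatEmb_ratFuncMapCoeffs (g : RatFunc F) :
    D.nfRatEmb (ratFuncMapCoeffs (algebraMap F Fbar) g) = algebraMap (RatFunc F) (RatAlgClosure F) g :=
  RingHom.congr_fun D.nfRatEmb_comp_ratFuncMapCoeffs g

/-- The `F̄(t)`-algebra structure on `Λ_F` through `θ` (a DEFINITION, deliberately not an instance; bind with `letI`).
([IUTchI] Ex 5.1 (i) p.124) [claim: Mochizuki2012, status: disputed] -/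
@[reducible] def nfRatAlgebra : Algebra (RatFunc Fbar) (RatAlgClosure F) := D.nfRatEmb.toAlgebra

/-- **`Λ_F` is an algebraic closure of `F̄(t)`** (through `θ`): it is algebraically closed, and algebraic already over
the smaller `F(t) ⊂ θ(F̄(t))`. ([IUTchI] Ex 5.1 (i) p.124) [claim: Mochizuki2012, status: disputed] -/
theorem isAlgClosure_nfRat : letI := D.nfRatAlgebra; IsAlgClosure (RatFunc Fbar) (RatAlgClosure F) := by
  letI := D.nfRatAlgebra
  refine ⟨inferInstance, ⟨fun y => ?_⟩⟩
  obtain ⟨p, hp0, hp⟩ := Algebra.IsAlgebraic.isAlgebraic (R := RatFunc F) y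
  refine ⟨p.map (ratFuncMapCoeffs (algebraMap F Fbar)),
    (Polynomial.map_ne_zero_iff (ratFuncMapCoeffs_injective (algebraMap F Fbar))).mpr hp0, ?_⟩
  rw [Polynomial.aeval_def, Polynomial.eval₂_map, RingHom.algebraMap_toAlgebra, nfRatEmb_comp_ratFuncMapCoeffs,
    ← Polynomial.aeval_def, hp]

/-! ### 3. `Λ_A ≃ Λ_F`: the identification of the reconstruction-presented closure with the model (`reconIdentification`) -/

namespace ReconRatObjects

variable {D} (R : D.ReconRatObjects)

/-- **`ψ_A : K_A ↪ Λ_F`** — the reconstructed NF-function field inside the model closure: `θ ∘ φ_A`.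
([IUTchI] Ex 5.1 (i) p.124) [claim: Mochizuki2012, status: disputed] -/
def funFieldEmb : R.funField →+* RatAlgClosure F := D.nfRatEmb.comp R.funFieldEquiv.toRingHom

/-- **The ARITHMETIC structure on `K_A`**: `F(t) → F̄(t) ≅ K_A` — the model's constant-field extension
`ratFuncMapCoeffs (F ↪ F̄)` followed by `φ_A⁻¹` (label (2) of the module docstring: the descent datum `F(t) ⊂ F̄(t)` is
TRANSPORTED from the model; the binder supplies no `Π`-equivariance of the comparison isomorphism).  A DEFINITION,
not an instance; it induces `Algebra (RatFunc F) Λ_A` and the scalar tower `F(t) → K_A → Λ_A` through Mathlib's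
`AlgebraicClosure` instances. ([IUTchI] Ex 5.1 (i) p.124) [claim: Mochizuki2012, status: disputed] -/
@[reducible] def funFieldAlgebra : Algebra (RatFunc F) R.funField :=
  ((R.funFieldEquiv.symm : RatFunc Fbar →+* R.funField).comp (ratFuncMapCoeffs (algebraMap F Fbar))).toAlgebra

/-- Unfolding of the arithmetic structure map `F(t) → K_A`. ([IUTchI] Ex 5.1 (i) p.124) [claim: Mochizuki2012, status: disputed] -/
theorem funFieldAlgebra_algebraMap_apply (g : RatFunc F) :
    letI := R.funFieldAlgebra
    algebraMap (RatFunc F) R.funField g = R.funFieldEquiv.symm (ratFuncMapCoeffs (algebraMap F Fbar) g) := rfl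

/-- `ψ_A` is over `F(t)`: `ψ_A ∘ (F(t) → K_A) = (F(t) → Λ_F)`. ([IUTchI] Ex 5.1 (i) p.124) [claim: Mochizuki2012, status: disputed] -/
theorem funFieldEmb_algebraMap (g : RatFunc F) :
    letI := R.funFieldAlgebra
    R.funFieldEmb (algebraMap (RatFunc F) R.funField g) = algebraMap (RatFunc F) (RatAlgClosure F) g := by
  rw [funFieldAlgebra_algebraMap_apply, funFieldEmb, RingHom.comp_apply, RingEquiv.toRingHom_eq_coe,
    RingEquiv.coe_toRingHom, RingEquiv.apply_symm_apply, nfRatEmb_ratFuncMapCoeffs]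

end ReconRatObjects

/-- **`InitialThetaData.reconIdentification` (GB-09, ruled name) — `e_A : Λ_A ≃+* Λ_F`**: the identification of the
reconstruction-presented closure `Λ_A = AlgebraicClosure K_A` with GB-01's model closure `Λ_F = RatAlgClosure F`, the
ring isomorphism EXTENDING `ψ_A = θ ∘ φ_A : K_A ≅ F̄(t) ↪ Λ_F` to the algebraic closures (Mathlib's
`IsAlgClosure.equivOfEquiv` — «`IsAlgClosed.equiv`-type», memo D9; a choice, label (2)).  It is `F(t)`-linear
(`reconIdentification_algebraMap_base`), hence conjugates `G_A^{rat}` onto `G_F^{rat}` bicontinuously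
(`reconRatGalEquiv`). ([IUTchI] Ex 5.1 (i) p.124) [claim: Mochizuki2012, status: disputed] -/
def reconIdentification (R : D.ReconRatObjects) : R.ratClosure ≃+* RatAlgClosure F :=
  letI := D.nfRatAlgebra
  haveI := D.isAlgClosure_nfRat
  haveI : Module.IsTorsionFree R.funField R.ratClosure := DivisionSemiring.to_moduleIsTorsionFree
  haveI : Module.IsTorsionFree (RatFunc Fbar) (RatAlgClosure F) := DivisionSemiring.to_moduleIsTorsionFree
  IsAlgClosure.equivOfEquiv R.ratClosure (RatAlgClosure F) R.funFieldEquiv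

namespace ReconRatObjects

variable {D} (R : D.ReconRatObjects)

/-- `e_A` EXTENDS `ψ_A`: on `K_A ⊂ Λ_A` it is `θ ∘ φ_A`. ([IUTchI] Ex 5.1 (i) p.124) [claim: Mochizuki2012, status: disputed] -/
theorem reconIdentification_algebraMap (s : R.funField) :
    D.reconIdentification R (algebraMap R.funField R.ratClosure s) = D.nfRatEmb (R.funFieldEquiv s) := by
  letI := D.nfRatAlgebra
  haveI := D.isAlgClosure_nfRat
  haveI : Module.IsTorsionFree R.funField R.ratClosure := DivisionSemiring.to_moduleIsTorsionFree
  haveI : Module.IsTorsionFree (RatFunc Fbar) (RatAlgClosure F) := DivisionSemiring.to_moduleIsTorsionFree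
  exact IsAlgClosure.equivOfEquiv_algebraMap R.ratClosure (RatAlgClosure F) R.funFieldEquiv s

/-- **`e_A` is `F(t)`-LINEAR**: on the arithmetic structure `F(t) → K_A → Λ_A` it is the structure map `F(t) → Λ_F`.
([IUTchI] Ex 5.1 (i) p.124) [claim: Mochizuki2012, status: disputed] -/
theorem reconIdentification_algebraMap_base (g : RatFunc F) :
    letI := R.funFieldAlgebra
    D.reconIdentification R (algebraMap (RatFunc F) R.ratClosure g) = algebraMap (RatFunc F) (RatAlgClosure F) g := by
  letI := R.funFieldAlgebra
  rw [IsScalarTower.algebraMap_apply (RatFunc F) R.funField R.ratClosure, reconIdentification_algebraMap]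
  exact R.funFieldEmb_algebraMap g

/-- **`e_A` as an isomorphism of `F(t)`-ALGEBRAS `Λ_A ≃ₐ[F(t)] Λ_F`** (for the transported arithmetic structure
`R.funFieldAlgebra`). ([IUTchI] Ex 5.1 (i) p.124) [claim: Mochizuki2012, status: disputed] -/
def reconIdentificationAlg : letI := R.funFieldAlgebra; R.ratClosure ≃ₐ[RatFunc F] RatAlgClosure F :=
  letI := R.funFieldAlgebra
  AlgEquiv.ofRingEquiv (f := D.reconIdentification R) R.reconIdentification_algebraMap_base

/-- `reconIdentificationAlg` is `reconIdentification` on elements. ([IUTchI] Ex 5.1 (i) p.124) [claim: Mochizuki2012, status: disputed] -/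
@[simp] theorem reconIdentificationAlg_apply (x : R.ratClosure) :
    R.reconIdentificationAlg x = D.reconIdentification R x := rfl

/-- `Λ_A` is ALGEBRAIC over `F(t)` (transport along `e_A` from `Λ_F / F(t)`). ([IUTchI] Ex 5.1 (i) p.124)
[claim: Mochizuki2012, status: disputed] -/
theorem isAlgebraic_ratClosure : letI := R.funFieldAlgebra; Algebra.IsAlgebraic (RatFunc F) R.ratClosure := by
  letI := R.funFieldAlgebra
  exact R.reconIdentificationAlg.symm.isAlgebraic

/-- `Λ_A` is INTEGRAL over `F(t)` (= algebraic; the form GB-01's `CoricPair.ofStableSet` consumes for open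
stabilisers). ([IUTchI] Ex 5.1 (i) p.124) [claim: Mochizuki2012, status: disputed] -/
theorem isIntegral_ratClosure : letI := R.funFieldAlgebra; Algebra.IsIntegral (RatFunc F) R.ratClosure := by
  letI := R.funFieldAlgebra
  haveI := R.isAlgebraic_ratClosure
  exact Algebra.IsAlgebraic.isIntegral

/-- `Λ_A / F(t)` is GALOIS (transport from GB-01's `isGalois_ratAlgClosure F`, characteristic `0`).
([IUTchI] Ex 5.1 (i) p.124) [claim: Mochizuki2012, status: disputed] -/
theorem isGalois_ratClosure : letI := R.funFieldAlgebra; IsGalois (RatFunc F) R.ratClosure := by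
  letI := R.funFieldAlgebra
  haveI := isGalois_ratAlgClosure F
  exact IsGalois.of_algEquiv R.reconIdentificationAlg.symm

/-! ### 4. `G_A^{rat}` and its bicontinuous identification with `G_F^{rat} = RatGal F` -/

/-- **`G_A^{rat} := Gal(Λ_A / F(t))`** — the RECONSTRUCTION-PRESENTED `π₁^{rat}(†𝒟^⊛)` of design (B): the group of
automorphisms of `Λ_A` over the (transported, label (2)) arithmetic structure `F(t) → K_A → Λ_A`, with Mathlib's Krull
topology (instances found through this `abbrev`; none is declared). ([IUTchI] Ex 5.1 (i) p.124)
[claim: Mochizuki2012, status: disputed] -/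
abbrev ratGal : Type u := letI := R.funFieldAlgebra; R.ratClosure ≃ₐ[RatFunc F] R.ratClosure

end ReconRatObjects

/-- **`ρ_A : G_A^{rat} ≃ₜ* G_F^{rat}`** — the identification of Galois groups INDUCED by `e_A` (conjugation
`σ ↦ e_A ∘ σ ∘ e_A⁻¹`, GB-07's `autCongrContinuous`): an isomorphism of TOPOLOGICAL groups for the two Krull topologies
(«Galois-compatible, topology transported», row GB-09). ([IUTchI] Ex 5.1 (i) p.124) [claim: Mochizuki2012, status: disputed] -/
def reconRatGalEquiv (R : D.ReconRatObjects) : R.ratGal ≃ₜ* RatGal F :=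
  letI := R.funFieldAlgebra
  autCongrContinuous R.reconIdentificationAlg

namespace ReconRatObjects

variable {D} (R : D.ReconRatObjects)

/-- `ρ_A σ = e_A ∘ σ ∘ e_A⁻¹` on elements of `Λ_F`. ([IUTchI] Ex 5.1 (i) p.124) [claim: Mochizuki2012, status: disputed] -/
theorem reconRatGalEquiv_apply_apply (σ : R.ratGal) (y : RatAlgClosure F) :
    D.reconRatGalEquiv R σ y = D.reconIdentification R (σ ((D.reconIdentification R).symm y)) := rfl

/-- **EQUIVARIANCE («Galois-compatible»)**: `e_A (σ • x) = ρ_A(σ) • e_A x` for `σ ∈ G_A^{rat}`, `x ∈ Λ_A`.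
([IUTchI] Ex 5.1 (i) p.124) [claim: Mochizuki2012, status: disputed] -/
theorem reconIdentification_smul (σ : R.ratGal) (x : R.ratClosure) :
    D.reconIdentification R (σ • x) = D.reconRatGalEquiv R σ • D.reconIdentification R x := by
  letI := R.funFieldAlgebra
  rw [AlgEquiv.smul_def, AlgEquiv.smul_def, reconRatGalEquiv_apply_apply, RingEquiv.symm_apply_apply]

/-- Equivariance, inverse form: `e_A⁻¹ (τ • y) = ρ_A⁻¹(τ) • e_A⁻¹ y`. ([IUTchI] Ex 5.1 (i) p.124)
[claim: Mochizuki2012, status: disputed] -/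
theorem reconIdentification_symm_smul (τ : RatGal F) (y : RatAlgClosure F) :
    (D.reconIdentification R).symm (τ • y) =
      (D.reconRatGalEquiv R).symm τ • (D.reconIdentification R).symm y := by
  letI := R.funFieldAlgebra
  apply (D.reconIdentification R).injective
  rw [reconIdentification_smul, RingEquiv.apply_symm_apply, RingEquiv.apply_symm_apply,
    ContinuousMulEquiv.apply_symm_apply]

/-- `G_A^{rat}` is COMPACT (profinite with the two facts below; transport of GB-01's `compactSpace_ratGal` along the
homeomorphism `ρ_A`). ([IUTchI] Ex 5.1 (i) p.124) [claim: Mochizuki2012, status: disputed] -/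
theorem compactSpace_ratGal : CompactSpace R.ratGal :=
  (D.reconRatGalEquiv R).toHomeomorph.symm.compactSpace

/-- `G_A^{rat}` is Hausdorff. ([IUTchI] Ex 5.1 (i) p.124) [claim: Mochizuki2012, status: disputed] -/
theorem t2Space_ratGal : T2Space R.ratGal :=
  (D.reconRatGalEquiv R).toHomeomorph.symm.t2Space

/-- `G_A^{rat}` is totally disconnected. ([IUTchI] Ex 5.1 (i) p.124) [claim: Mochizuki2012, status: disputed] -/
theorem totallyDisconnectedSpace_ratGal : TotallyDisconnectedSpace R.ratGal :=
  (D.reconRatGalEquiv R).toHomeomorph.symm.totallyDisconnectedSpace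

/-- Galois descent in `Λ_A`: the `G_A^{rat}`-fixed elements are exactly (the image of) `F(t)` — print's «`𝕄_κ` = the
`π₁^{rat}`-invariants» mechanism at the reconstruction presentation (Mathlib `InfiniteGalois.mem_range_algebraMap_iff_fixed`,
`Λ_A / F(t)` Galois). ([IUTchI] Ex 5.1 (i) p.124) [claim: Mochizuki2012, status: disputed] -/
theorem mem_range_algebraMap_iff_fixed (x : R.ratClosure) :
    letI := R.funFieldAlgebra
    x ∈ Set.range (algebraMap (RatFunc F) R.ratClosure) ↔ ∀ σ : R.ratGal, σ x = x := by
  letI := R.funFieldAlgebra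
  haveI := R.isGalois_ratClosure
  exact InfiniteGalois.mem_range_algebraMap_iff_fixed x

end ReconRatObjects

end InitialThetaData

end Literature.IUT.HodgeTheaters

end
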